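import Literature.NumberTheory.GaloisRepresentations.PstWeilDeligneDualDeRham
import Literature.NumberTheory.GaloisRepresentations.AdmissibleTwist
import HarnessLib

/-!
# A two-dimensional representation with two independent period maps and a period for `det⁻¹` is admissible

Topic `NumberTheory/GaloisRepresentations`; theorems only (no definition, no named fact). Generic `p`-adic Hodge theory
for a period-ring datum `𝔅 : PeriodRingData Γ P E` (accepted `PAdicHodge`), continuing `PstWeilDeligneDualDeRham`
(`tensorRep_basis_apply`, period matrices) and `AdmissibleTwist` (periods of characters). The situation of the period
maps of an elliptic curve / a `p`-divisible group of height 2 (Fontaine 1977/1982, Colmez 1992 §2): one is NOT given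
invariant vectors of `B ⊗_P V` but `Γ`-EQUIVARIANT `P`-LINEAR MAPS `φ : V → B` (`σ(φ v) = φ(ρ(σ) v)`: the integrals
`τ ↦ ∫_τ ω`, `τ ↦ ∫_τ η` on the Tate module), together with a period of the inverse determinant (`s = t⁻¹`,
`det ρ = χ_cyc`, `σ t = χ(σ) t`). Then:

* `tensorRep_cross` — for an equivariant `φ` and a basis `(v₀, v₁)` of `V`, the "cross vector"
  `y_φ = φ(v₁) ⊗ v₀ − φ(v₀) ⊗ v₁ ∈ B ⊗_P V` satisfies `σ(y_φ) = det ρ(σ) · y_φ` (a `2 × 2` identity);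
* `cross_smul_mem_D` — hence `s · y_φ ∈ D_B(V)` when `det ρ(σ) · σ(s) = s`;
* **`isAdmissible_of_two_periodMaps`** — if `dim_P V = 2`, `φ₁, φ₂ : V → B` are equivariant and `E`-linearly independent
  (`a φ₁ + b φ₂ = 0`, `a, b ∈ E` ⇒ `a = b = 0`) and `s ≠ 0` is a period of `det⁻¹`, then `V` is `B`-admissible:
  `s·y_{φ₁}, s·y_{φ₂}` are `E`-independent in `D_B(V)` (coordinates in the `B`-basis `1 ⊗ vᵢ`), so
  `2 ≤ dim_E D_B(V) ≤ dim_P V = 2` (Fontaine's inequality `finrank_D_le_holds`).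

No determinant of the period matrix ("Legendre relation") is needed: by `linearIndependent_of_mem_D` it is a CONSEQUENCE.
BSD context: this is the assembly step (A6a) of the hDR sector (iii) of crux K★ `stmt-BirchSwinnertonDyer-22226`
(`V = V_pŴ`, `B = B_dR`, `φ₁ = ∫ω ∈ Fil¹`, `φ₂ = ∫η ∉ Fil¹`); BSD is not proved by any of this.

## References
* [FontaineAsterisque223III] J.-M. Fontaine, *Représentations p-adiques semi-stables*, Astérisque 223 (1994), Exp. III,
  §1.4, Prop. 1.5.2, Thm. 1.5.2.
* [Colmez1992PeriodesAbeliennes] P. Colmez, *Périodes p-adiques des variétés abéliennes*, Math. Ann. 292 (1992), §2.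
* [FontaineOuyang2022] J.-M. Fontaine, Y. Ouyang, *Theory of p-adic Galois representations*, Thm. 2.13.
-/

noncomputable section

open scoped TensorProduct Matrix

namespace Literature.NumberTheory.GaloisRepresentations

namespace PeriodRingData

set_option maxSynthPendingDepth 3

universe u v v' w w'

variable {Γ : Type u} [Group Γ] [TopologicalSpace Γ] {P : Type v} {E : Type v'} [Field P]
  [TopologicalSpace P] [Field E] [Algebra P E]
  {M : Type w'} [AddCommGroup M] [Module P M] [TopologicalSpace M]
  (𝔅 : PeriodRingData.{u, v, v', w} Γ P E) (ρ : ContinuousRep Γ P M)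

/-- Rows transform by the matrix: for an equivariant `φ`, `σ(φ(vⱼ)) = Σᵢ R(σ)ᵢⱼ φ(vᵢ)` (the period ROW of `φ` satisfies
`σ(r) = r·R(σ)`). [cite: FontaineAsterisque223III, Exp. III §1.5 (period matrices)] -/
theorem smul_periodMap_basis {ι : Type*} [Fintype ι] [DecidableEq ι] (v : Module.Basis ι P M)
    (φ : M →ₗ[P] 𝔅.B) (hφ : ∀ (σ : Γ) (m : M), σ • φ m = φ (ρ σ m)) (σ : Γ) (j : ι) :
    σ • φ (v j) = ∑ i, algebraMap P 𝔅.B (LinearMap.toMatrix v v (ρ σ) i j) * φ (v i) := by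
  have hR : ρ σ (v j) = ∑ i, LinearMap.toMatrix v v (ρ σ) i j • v i := by
    have h1 := Matrix.toLin_self v v (LinearMap.toMatrix v v (ρ σ : M →ₗ[P] M)) j
    rwa [Matrix.toLin_toMatrix] at h1
  rw [hφ, hR, map_sum]
  exact Finset.sum_congr rfl fun i _ => by rw [map_smul, Algebra.smul_def]

/-- **The cross vector transforms by the determinant**: for an equivariant `φ : V → B` and a basis `(v₀, v₁)`,
`σ(φ(v₁) ⊗ v₀ − φ(v₀) ⊗ v₁) = det ρ(σ) · (φ(v₁) ⊗ v₀ − φ(v₀) ⊗ v₁)`. [cite: FontaineAsterisque223III, Exp. III Prop. 1.5.2] -/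
theorem tensorRep_cross (v : Module.Basis (Fin 2) P M) (φ : M →ₗ[P] 𝔅.B) (hφ : ∀ (σ : Γ) (m : M), σ • φ m = φ (ρ σ m))
    (σ : Γ) :
    𝔅.tensorRep ρ σ (φ (v 1) • Algebra.TensorProduct.basis 𝔅.B v 0 - φ (v 0) • Algebra.TensorProduct.basis 𝔅.B v 1) =
      algebraMap P 𝔅.B (LinearMap.det (ρ σ : M →ₗ[P] M)) •
        (φ (v 1) • Algebra.TensorProduct.basis 𝔅.B v 0 - φ (v 0) • Algebra.TensorProduct.basis 𝔅.B v 1) := by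
  classical
  have hdet : LinearMap.det (ρ σ : M →ₗ[P] M) =
      LinearMap.toMatrix v v (ρ σ) 0 0 * LinearMap.toMatrix v v (ρ σ) 1 1 -
        LinearMap.toMatrix v v (ρ σ) 0 1 * LinearMap.toMatrix v v (ρ σ) 1 0 := by
    rw [← LinearMap.det_toMatrix v, Matrix.det_fin_two]
  rw [map_sub, tensorRep_apply_smul, tensorRep_apply_smul, 𝔅.tensorRep_basis_apply ρ v σ 0, 𝔅.tensorRep_basis_apply ρ v σ 1,
    𝔅.smul_periodMap_basis ρ v φ hφ σ 1, 𝔅.smul_periodMap_basis ρ v φ hφ σ 0, hdet]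
  simp only [Fin.sum_univ_two, map_sub, map_mul, smul_add, smul_smul]
  module

/-- **`s · y_φ ∈ D_B(V)`** for a period `s` of `det⁻¹` (`det ρ(σ) · σ(s) = s`). [cite: FontaineAsterisque223III, Exp. III Prop. 1.5.2] -/
theorem cross_smul_mem_D (v : Module.Basis (Fin 2) P M) (φ : M →ₗ[P] 𝔅.B) (hφ : ∀ (σ : Γ) (m : M), σ • φ m = φ (ρ σ m))
    {s : 𝔅.B} (hs : ∀ σ : Γ, algebraMap P 𝔅.B (LinearMap.det (ρ σ : M →ₗ[P] M)) * σ • s = s) :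
    s • (φ (v 1) • Algebra.TensorProduct.basis 𝔅.B v 0 - φ (v 0) • Algebra.TensorProduct.basis 𝔅.B v 1) ∈ 𝔅.D ρ := by
  rw [mem_D_iff]
  intro σ
  rw [tensorRep_apply_smul, 𝔅.tensorRep_cross ρ v φ hφ σ, smul_smul, mul_comm, hs σ]

/-- **A two-dimensional representation with two `E`-independent equivariant period maps `V → B` and a nonzero period of
`det⁻¹` is `B`-admissible** (no Legendre relation needed). [cite: FontaineAsterisque223III, Exp. III Thm. 1.5.2]
[cite: Colmez1992PeriodesAbeliennes, §2] -/
theorem isAdmissible_of_two_periodMaps [FiniteDimensional P M] (h2 : Module.finrank P M = 2)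
    (φ₁ φ₂ : M →ₗ[P] 𝔅.B) (hφ₁ : ∀ (σ : Γ) (m : M), σ • φ₁ m = φ₁ (ρ σ m))
    (hφ₂ : ∀ (σ : Γ) (m : M), σ • φ₂ m = φ₂ (ρ σ m))
    (hind : ∀ a b : E, (∀ m : M, a • φ₁ m + b • φ₂ m = 0) → a = 0 ∧ b = 0)
    {s : 𝔅.B} (hs0 : s ≠ 0) (hs : ∀ σ : Γ, algebraMap P 𝔅.B (LinearMap.det (ρ σ : M →ₗ[P] M)) * σ • s = s) :
    𝔅.IsAdmissible ρ := by
  classical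
  haveI := 𝔅.finite_D ρ
  let v : Module.Basis (Fin 2) P M := Module.finBasisOfFinrankEq P M h2
  let β := Algebra.TensorProduct.basis 𝔅.B v
  let y : (M →ₗ[P] 𝔅.B) → 𝔅.B ⊗[P] M := fun φ => φ (v 1) • β 0 - φ (v 0) • β 1
  have hy₁ : s • y φ₁ ∈ 𝔅.D ρ := 𝔅.cross_smul_mem_D ρ v φ₁ hφ₁ hs
  have hy₂ : s • y φ₂ ∈ 𝔅.D ρ := 𝔅.cross_smul_mem_D ρ v φ₂ hφ₂ hs
  -- `E`-independence of `s • y φ₁`, `s • y φ₂` inside `D`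
  have hli : LinearIndependent E ![(⟨s • y φ₁, hy₁⟩ : 𝔅.D ρ), ⟨s • y φ₂, hy₂⟩] := by
    rw [LinearIndependent.pair_iff]
    intro a b hab
    have h0 : algebraMap E 𝔅.B a • y φ₁ + algebraMap E 𝔅.B b • y φ₂ = 0 := by
      have h1 := congrArg Subtype.val hab
      simp only [Submodule.coe_add, Submodule.coe_smul_of_tower, Submodule.coe_zero] at h1
      rw [← algebraMap_smul 𝔅.B a, ← algebraMap_smul 𝔅.B b, smul_comm _ s, smul_comm _ s, ← smul_add] at h1
      exact (smul_eq_zero_iff_right hs0).1 h1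
    -- coordinates in the `B`-basis `β`
    have hβ : LinearIndependent 𝔅.B ![β 0, β 1] := by
      have h : (![β 0, β 1] : Fin 2 → 𝔅.B ⊗[P] M) = β := by
        funext i; fin_cases i <;> rfl
      rw [h]; exact β.linearIndependent
    have hcomb : algebraMap E 𝔅.B a • y φ₁ + algebraMap E 𝔅.B b • y φ₂ =
        (algebraMap E 𝔅.B a * φ₁ (v 1) + algebraMap E 𝔅.B b * φ₂ (v 1)) • β 0 +
          (-(algebraMap E 𝔅.B a * φ₁ (v 0) + algebraMap E 𝔅.B b * φ₂ (v 0))) • β 1 := by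
      simp only [y]
      module
    rw [hcomb] at h0
    obtain ⟨A1, A0⟩ := (LinearIndependent.pair_iff.1 hβ) _ _ h0
    rw [neg_eq_zero] at A0
    refine hind a b fun m => ?_
    rw [← v.sum_repr m]
    simp only [Fin.sum_univ_two, map_add, map_smul, Algebra.smul_def]
    linear_combination algebraMap P 𝔅.B (v.repr m 0) * A0 + algebraMap P 𝔅.B (v.repr m 1) * A1
  have h2le : 2 ≤ Module.finrank E (𝔅.D ρ) := by
    simpa using hli.fintype_card_le_finrank
  have h3 : Module.finrank E (𝔅.D ρ) ≤ Module.finrank P M := 𝔅.finrank_D_le_holds ρ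
  unfold IsAdmissible
  omega

end PeriodRingData

end Literature.NumberTheory.GaloisRepresentations

end
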